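import Literature.MathematicalPhysics.QuantumFieldTheory.Balaban1983to89.B1Ineq224BackgroundTorusWalk

/-!
# `Balaban1983to89.B1Ineq224BackgroundTorus` — [Balaban1982Higgs1] PROP. 2.1 (2.24), THE HÖLDER CLAUSE WITH ITS DECAY FACTOR, AT THE REGULAR
# BACKGROUND `A^{(K),ε} ≠ 0` OF (3.29) ON `Ω = T_ε` = [Balaban1983RegularityDecay] THEOREM (1.9) HÖLDER MEMBER WITH `exp(−δ₀dist)` FOR THE
# (Higgs)₂,₃ CARRIER: the two regimes of p. 578 («If |x′ − x| > 1, then this inequality is a simple consequence of the corresponding inequality for the derivative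
# only» — gen 9's derivative clause at both bonds; «hence we can assume |x′ − x| ≦ 1» — the walk and the per-cube inputs at `Ã_j` of
# `B1Ineq224BackgroundTorusWalk`)

statement-level skeleton of published theorems with citation tags; proofs where landed; nothing here is a claim about the Yang–Mills mass gap

CITATION HEADER (lean-in-tree rule).  T. Bałaban, *(Higgs)₂,₃ quantum fields in a finite volume. I*, Commun. Math. Phys. **85** (1982) 603–626
[Balaban1982Higgs1] (Prop. 2.1 (2.23)–(2.25) p. 610, (3.29) p. 617) and T. Bałaban, *Regularity and decay of lattice Green's functions*, Commun.
Math. Phys. **89** (1983) 571–597 [Balaban1983RegularityDecay] (Theorem (1.9)–(1.10) p. 573, Lemma 2.2 p. 578, (2.18)–(2.22) pp. 578–579).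
Cell `lit-balaban` (HOME `run/shared/lean/pub/lit-balaban/`), Phase-2 proof seat **p35** gen 10 (unit `lit-balaban-p35`); SKELETON rows
**B1.Prop2.1** ((2.24) HÖLDER clause at `A = A^{(K),ε} ≠ 0`, `Ω = T_ε` — model instance), **B4.Thm@573** ((1.9) with its decay factor at a
regular `A ≠ 0` on the torus).  USED BY NAME, never restated: gen 9's `B1Ineq225DerivDecayBackgroundTorus.norm_covDeriv_propagatorK_bgVec_decay_of_cubes`
(far regime), gen 8's `B1Ineq225BackgroundTorus.three_half_le_sites`, gen 9's `B1Ineq225DecayBackgroundTorus.eight_rS_le`; this seat's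
`B1Ineq224BackgroundTorusWalk.{norm_holder_propagatorK_univ_le, cube_inputs_holder_bgVec}`, `B1TorusChainTransport.{hol, IsTChain, norm_hol_apply}`.

WHAT IS PRINTED.  [Balaban1982Higgs1] p. 610 (L25–38), for the propagator `G_k(Ω,A)` RESCALED TO THE `η = L^{−k}`-LATTICE (2.22): *«Proposition 2.1.
… let a configuration A be regular on Ω in the sense that (2.23) … For an arbitrary pair of points x, x′ ∈ T_η let us denote by Γ_{x,x′} a shortest
contour connecting these points. Then for e(L^kε) sufficiently small and α < 1 there exist positive constants δ₀, c₀, R₀ independent of A, k, Ω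
and depending on d, a, M only, c₀ on α also, such that for an arbitrary function f : Ω → R^N we have
(1/|x − x′|^α)|U(A(Γ_{x,x′}))(D^η_{A,μ}G_k(Ω,A)f)(x′) − (D^η_{A,μ}G_k(Ω,A)f)(x)| ≦ c₀exp(−δ₀dist({x,x′}, supp f))‖f‖_∞ (2.24) for x, x′ ∈ Ω and
satisfying the condition dist({x,x′},Ω^c) ≧ R₀»*.  READING USED HERE ((2.24) rescaled back to `T_ε`): `G^ε_k = (L^kε)²·G_k`, `D^ε = (L^kε)^{−1}D^η`
and `|x − x′|`, `dist` in `L^kε`-units, whence the factor `c₀(L^kε)` and the rate `δ₀·dist/(L^kε)` below — a unit conversion, not a quotation.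
[Balaban1983RegularityDecay] p. 573 (1.9) and p. 578: *«If |x′ − x| > 1, then this inequality is a simple consequence of the corresponding inequality for the derivative only,
hence we can assume |x′ − x| ≦ 1»*; p. 579: *«if Ω is a rectangular parallelepiped, then all □_j in the representation (2.13) are cubes and we can apply Lemma
2.2 to all operators in it»*.  (Docfix S-B1-g39-1/S-B1-g39-2 of ref-4 gen 39, filed gen 13: the p. 578 sentence quoted as printed and the
constants line «d, a, M only, c₀ on α also» read on the ×2 render; no declaration changed.)

WHAT THIS FILE PROVES (kernel-checked, zero `sorry`, theorems only + two private helpers; axioms standard).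
* **`norm_holder_propagatorK_bgVec_decay_of_cubes`** — PROP. 2.1 (2.24) / THEOREM (1.9) WITH ITS DECAY FACTOR AT `A^{(K),ε}` ON `T_ε`: for
  `d ≧ 1`, odd `L > 1`, `a, μ₀², m² > 0`, `N`, `(e,q)`, `ε₀`, `0 ≦ α < 1`: constants `c₀ > 0`, `K₀min`, thresholds `c_A(K₀) > 0`, rates
  `δ₀(K₀) > 0` such that for `K₀ ≧ K₀min`, `K₀ ∣ M`, `1 ≦ K ≦ K_P`, `3L^KK₀ ≦ |T_ε|_μ`, `L^Kε ≦ ε₀`, `r·L^Kε ≦ c_A(K₀)`, `|A| ≦ r`, every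
  `‖g‖_∞ ≦ M′` vanishing within (1.3)-distance `< D` of `x` and of `x′` (`D ≧ 0`), every `μ`, `x′ ≠ x` and nearest-neighbour chain `Γ` from
  `x` to `x′` with `|Γ| ≦ d|x − x′|`:
  `(|x − x′|/L^K)^{−α}‖U(A^{(K),ε}(Γ))(D^ε_{A^{(K),ε}}G^ε_K(T_ε,A^{(K),ε})g)(⟨x′,μ⟩) − (D^ε_{A^{(K),ε}}G^ε_K(T_ε,A^{(K),ε})g)(⟨x,μ⟩)‖
   ≦ c₀(L^Kε)exp(−δ₀(K₀)D/L^K)M′`; packaging `norm_holder_propagatorK_bgVec_decay` (cube condition `K₀ ∣ M`, `3K₀ ≦ 2M`).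
HONEST SCOPE: `Ω = T_ε` only (no boundary term `dist({x,x′},Ω^c) ≧ R₀`); the shortest-contour family is represented by ANY nearest-neighbour
chain with `|Γ| ≦ d|x − x′|` (which contains the shortest contours of the (1.3)-metric); distances in level-`K` lattice units (`dist/L^Kε
= D/L^K`); `0 ≦ α < 1`; constants depend on `(d, L, N, e, q, a, μ₀², m², ε₀, α)`, `c_A, δ₀` on `K₀` (the print's `δ₀, c₀` depend on `d, α, M`
and `a` only — our constants are not claimed uniform in the other data); the walk is summed in the exponentially
weighted sup norm (declared deviation of `B4Eq222SupDecay`).  Unit `lit-balaban-p35` gen 10 (literature-prover-lit-balaban-p35-g10-0).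
-/

open scoped BigOperators

noncomputable section

namespace Literature.MathematicalPhysics.QuantumFieldTheory.Balaban1983to89.B1Ineq224BackgroundTorus

open Literature.MathematicalPhysics.QuantumFieldTheory.Balaban1983to89.HiggsLattice (ChargeData sderiv covDeriv)
open Literature.MathematicalPhysics.QuantumFieldTheory.Balaban1983to89.HiggsCovariance (propagatorK covOpK)
open Literature.MathematicalPhysics.QuantumFieldTheory.Balaban1983to89.B3MultiscaleFields (toSite)
open Literature.MathematicalPhysics.QuantumFieldTheory.Balaban1983to89.B1Eq31Concrete (bgVec)
open Literature.MathematicalPhysics.QuantumFieldTheory.Balaban1983to89.B1Eq211ZeroFieldTorus (Shape)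
open Literature.MathematicalPhysics.QuantumFieldTheory.Balaban1983to89.B1TorusCubeCover (half Lab Near cube hTor)
open Literature.MathematicalPhysics.QuantumFieldTheory.Balaban1983to89.B1TorusCubeLocality26 (rS cubeVec)
open Literature.MathematicalPhysics.QuantumFieldTheory.Balaban1983to89.B1TorusCubeChart (dd dd_succ)
open Literature.MathematicalPhysics.QuantumFieldTheory.Balaban1983to89.B4GaugeCovariance (pathEnd)
open Literature.MathematicalPhysics.QuantumFieldTheory.Balaban1983to89.B4PartitionUnity22 (hprof D1 D2 D1_nonneg D2_nonneg contDiff_hprof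
  hasCompactSupport_hprof)
open Literature.MathematicalPhysics.QuantumFieldTheory.Balaban1983to89.B1Ineq225BackgroundTorus (three_half_le_sites)
open Literature.MathematicalPhysics.QuantumFieldTheory.Balaban1983to89.B1Ineq225DecayBackgroundTorus (eight_rS_le)
open Literature.MathematicalPhysics.QuantumFieldTheory.Balaban1983to89.B1Ineq225DerivDecayBackgroundTorus (norm_covDeriv_propagatorK_bgVec_decay_of_cubes)
open Literature.MathematicalPhysics.QuantumFieldTheory.Balaban1983to89.B1TorusChainTransport (IsTChain hol norm_hol_apply)
open Literature.MathematicalPhysics.QuantumFieldTheory.Balaban1983to89.B1Ineq224BackgroundTorusWalk (norm_holder_propagatorK_univ_le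
  cube_inputs_holder_bgVec)

variable {P : HiggsLattice.Params} {N : ℕ}

/-! ## (2.24) / (1.9) with its decay factor on `T_ε` at the background `A^{(K),ε}`: the two regimes of p. 578 -/

section Main

/-- distinct torus sites are at (1.3)-distance at least one lattice unit. [cite: Balaban1982Higgs1, (1.3) p.604] -/
private theorem one_le_tdist_of_ne {k : ℕ} {x x' : HiggsLattice.Site P k} (h : x' ≠ x) : 1 ≤ HiggsLattice.Site.tdist x x' := by
  obtain ⟨μ, hμ⟩ : ∃ μ, x' μ ≠ x μ := by
    by_contra hc
    push Not at hc
    exact h (funext hc)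
  unfold HiggsLattice.Site.tdist
  refine le_trans ?_ (Finset.le_sup (f := fun ν : Fin P.d => min (x ν - x' ν).val (x' ν - x ν).val) (Finset.mem_univ μ))
  refine le_min ?_ ?_
  · exact Nat.one_le_iff_ne_zero.2 fun h0 => hμ (sub_eq_zero.1 ((ZMod.val_eq_zero _).1 h0)).symm
  · exact Nat.one_le_iff_ne_zero.2 fun h0 => hμ (sub_eq_zero.1 ((ZMod.val_eq_zero _).1 h0))

/-- the near-regime bookkeeping: `γ_T ≦ C_near·(t/n)^α·(L^Kε)` for `1 ≦ t ≦ n`, `|Γ| ≦ dt`, `K₀ ≧ 8`. [folklore] -/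
private theorem gammaT_le {Pd K₀ : ℕ} (hK₀8 : 8 ≤ K₀) {D₁ D₂ CH Cδ Cγ t n m0 ℓ α : ℝ} (hD₁ : 0 ≤ D₁) (hD₂ : 0 ≤ D₂)
    (hCδ : 0 ≤ Cδ) (hCγ : 0 ≤ Cγ) (hn : 0 < n) (hm0 : 0 < m0) (ht1 : 1 ≤ t) (htn : t ≤ n) (hℓ0 : 0 ≤ ℓ)
    (hℓ : ℓ ≤ (Pd : ℝ) * t) (hα1 : α < 1) :
    CH * (t / n) ^ α * (n * m0) + (Pd : ℝ) * (D₁ + D₂) / (K₀ : ℝ) * ((2 * ℓ + 2) / n) * (Cδ * (n * m0))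
        + (D₁ ^ 2 + D₂) / (K₀ : ℝ) ^ 2 * ((Pd : ℝ) * ℓ / (n ^ 2 * m0)) * (Cγ * (n * m0) ^ 2)
      ≤ (CH + (Pd : ℝ) * (D₁ + D₂) / 8 * (2 * (Pd : ℝ) + 2) * Cδ + (D₁ ^ 2 + D₂) / 64 * (Pd : ℝ) ^ 2 * Cγ) * (t / n) ^ α * (n * m0) := by
  have hK₀r : (8 : ℝ) ≤ K₀ := by exact_mod_cast hK₀8
  have ht0 : 0 < t := lt_of_lt_of_le one_pos ht1
  have hq0 : 0 < t / n := div_pos ht0 hn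
  have hq1 : t / n ≤ 1 := (div_le_one hn).2 htn
  set w : ℝ := (t / n) ^ α with hw
  have hqw : t / n ≤ w := by
    have h := Real.rpow_le_rpow_of_exponent_ge hq0 hq1 hα1.le
    rwa [Real.rpow_one] at h
  have hw0 : 0 ≤ w := Real.rpow_nonneg hq0.le α
  have hPd : (0 : ℝ) ≤ Pd := Nat.cast_nonneg _
  -- second term
  have h2a : (Pd : ℝ) * (D₁ + D₂) / (K₀ : ℝ) ≤ (Pd : ℝ) * (D₁ + D₂) / 8 :=
    div_le_div_of_nonneg_left (by positivity) (by norm_num) hK₀r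
  have h2b : (2 * ℓ + 2) / n ≤ (2 * (Pd : ℝ) + 2) * w := by
    have h1 : 2 * ℓ + 2 ≤ (2 * (Pd : ℝ) + 2) * t := by nlinarith
    calc (2 * ℓ + 2) / n ≤ (2 * (Pd : ℝ) + 2) * t / n := div_le_div_of_nonneg_right h1 hn.le
      _ = (2 * (Pd : ℝ) + 2) * (t / n) := by ring
      _ ≤ (2 * (Pd : ℝ) + 2) * w := mul_le_mul_of_nonneg_left hqw (by positivity)
  have h2 : (Pd : ℝ) * (D₁ + D₂) / (K₀ : ℝ) * ((2 * ℓ + 2) / n) * (Cδ * (n * m0))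
      ≤ (Pd : ℝ) * (D₁ + D₂) / 8 * ((2 * (Pd : ℝ) + 2) * w) * (Cδ * (n * m0)) := by
    have h2c : 0 ≤ (2 * ℓ + 2) / n := by positivity
    gcongr
  -- third term
  have h3a : (D₁ ^ 2 + D₂) / (K₀ : ℝ) ^ 2 ≤ (D₁ ^ 2 + D₂) / 64 :=
    div_le_div_of_nonneg_left (by positivity) (by norm_num) (by nlinarith)
  have h3e : (D₁ ^ 2 + D₂) / (K₀ : ℝ) ^ 2 * ((Pd : ℝ) * ℓ / (n ^ 2 * m0)) * (Cγ * (n * m0) ^ 2)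
      = (D₁ ^ 2 + D₂) / (K₀ : ℝ) ^ 2 * ((Pd : ℝ) * ℓ) * (Cγ * m0) := by
    field_simp
  have h3b : (Pd : ℝ) * ℓ ≤ (Pd : ℝ) ^ 2 * w * n := by
    calc (Pd : ℝ) * ℓ ≤ (Pd : ℝ) * ((Pd : ℝ) * t) := mul_le_mul_of_nonneg_left hℓ hPd
      _ = (Pd : ℝ) ^ 2 * (t / n) * n := by field_simp
      _ ≤ (Pd : ℝ) ^ 2 * w * n := by gcongr
  have h3 : (D₁ ^ 2 + D₂) / (K₀ : ℝ) ^ 2 * ((Pd : ℝ) * ℓ / (n ^ 2 * m0)) * (Cγ * (n * m0) ^ 2)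
      ≤ (D₁ ^ 2 + D₂) / 64 * ((Pd : ℝ) ^ 2 * w * n) * (Cγ * m0) := by
    rw [h3e]
    have : 0 ≤ (Pd : ℝ) * ℓ := by positivity
    gcongr
  calc CH * (t / n) ^ α * (n * m0) + (Pd : ℝ) * (D₁ + D₂) / (K₀ : ℝ) * ((2 * ℓ + 2) / n) * (Cδ * (n * m0))
        + (D₁ ^ 2 + D₂) / (K₀ : ℝ) ^ 2 * ((Pd : ℝ) * ℓ / (n ^ 2 * m0)) * (Cγ * (n * m0) ^ 2)
      ≤ CH * w * (n * m0) + (Pd : ℝ) * (D₁ + D₂) / 8 * ((2 * (Pd : ℝ) + 2) * w) * (Cδ * (n * m0))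
        + (D₁ ^ 2 + D₂) / 64 * ((Pd : ℝ) ^ 2 * w * n) * (Cγ * m0) := by rw [hw]; linarith
    _ = (CH + (Pd : ℝ) * (D₁ + D₂) / 8 * (2 * (Pd : ℝ) + 2) * Cδ + (D₁ ^ 2 + D₂) / 64 * (Pd : ℝ) ^ 2 * Cγ) * w * (n * m0) := by
        ring

set_option maxHeartbeats 800000 in
/-- **PROP. 2.1 (2.24), HÖLDER CLAUSE WITH ITS DECAY FACTOR, ON `Ω = T_ε` AT THE BACKGROUND `A^{(K),ε}` OF (3.29) — B4's THEOREM (1.9) HÖLDER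
MEMBER WITH `exp(−δ₀dist)` FOR THE (Higgs)₂,₃ CARRIER AT A REGULAR `A ≠ 0`.**  For `d ≧ 1`, odd `L > 1`, `a, μ₀², m² > 0`, `N`, `(e, q)`, `ε₀`,
`0 ≦ α < 1`: constants `c₀ > 0`, `K₀min`, and per cube size `K₀` a threshold `c_A(K₀) > 0` and a rate `δ₀(K₀) > 0`, such that for `K₀ ≧ K₀min`,
on every torus `M·L′_μ = L^m` with `K₀ ∣ M`, at every level `1 ≦ K ≦ K_P` with `3·L^KK₀ ≦ |T_ε|_μ`, `L^Kε ≦ ε₀`, for `r·L^Kε ≦ c_A(K₀)`, every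
`|A(x)| ≦ r`, every `g` with `‖g‖_∞ ≦ M′` vanishing at the sites within (1.3)-distance `< D` of `x` and of `x′` (`D ≧ 0`), every direction `μ`,
sites `x′ ≠ x` and nearest-neighbour chain `Γ` from `x` to `x′` with `|Γ| ≦ d|x − x′|`:
`(|x − x′|/L^K)^{−α}·‖U(A^{(K),ε}(Γ))(D^ε_{A^{(K),ε}}G^ε_K(T_ε, A^{(K),ε})g)(⟨x′,μ⟩) − (D^ε_{A^{(K),ε}}G^ε_K(T_ε, A^{(K),ε})g)(⟨x,μ⟩)‖
 ≦ c₀(L^Kε)·exp(−δ₀(K₀)·D/L^K)·M′`.  Proof: `|x − x′| ≦ L^K` by `norm_holder_propagatorK_univ_le` with §1 (`δ = log 2/(2(rS + dL^K + 2))`);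
`|x − x′| > L^K` from the derivative clause `norm_covDeriv_propagatorK_bgVec_decay_of_cubes` at both bonds («a simple consequence of the
corresponding inequality for the derivative only»).
[cite: Balaban1982Higgs1, Prop. 2.1 (2.24) p.610; (3.29) p.617] [cite: Balaban1983RegularityDecay, Theorem (1.9) p.573; p.578; (2.22) p.579] -/
theorem norm_holder_propagatorK_bgVec_decay_of_cubes (d L : ℕ) (hd : 1 ≤ d) (hL : Odd L ∧ 1 < L) {a : ℝ} (ha : 0 < a)
    {mu0sq msq : ℝ} (hmu : 0 < mu0sq) (hmsq : 0 < msq) (N : ℕ) (C : ChargeData N) (ε₀ : ℝ) {α : ℝ} (hα0 : 0 ≤ α) (hα1 : α < 1) :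
    ∃ c₀ : ℝ, 0 < c₀ ∧ ∃ K₀min : ℕ, ∃ cA δA : ℕ → ℝ, (∀ K₀, 0 < cA K₀ ∧ 0 < δA K₀) ∧ ∀ K₀ : ℕ, K₀min ≤ K₀ →
      ∀ (P : HiggsLattice.Params) (_S : Shape P), P.d = d → P.L = L → K₀ ∣ P.M →
      ∀ {K : ℕ}, 1 ≤ K → K ≤ P.K → (∀ μ, 3 * half P K K₀ ≤ P.sitesPerDir 0 μ) → P.mesh K ≤ ε₀ →
      ∀ {r : ℝ}, r * P.mesh K ≤ cA K₀ →
      ∀ A : HiggsLattice.VecField P K, (∀ x, ‖toSite A x‖ ≤ r) →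
        ∀ (g : HiggsLattice.ScalarField P 0 N) (M D : ℝ), (∀ x, ‖g x‖ ≤ M) → 0 ≤ D →
          ∀ (μ : Fin P.d) (x x' : HiggsLattice.Site P 0), x' ≠ x → ∀ l : List (HiggsLattice.Site P 0), IsTChain x l → pathEnd x l = x' →
            (l.length : ℝ) ≤ (P.d : ℝ) * HiggsLattice.Site.tdist x x' →
            (∀ z, g z ≠ 0 → D ≤ (HiggsLattice.Site.tdist x z : ℝ)) → (∀ z, g z ≠ 0 → D ≤ (HiggsLattice.Site.tdist x' z : ℝ)) →
              (((HiggsLattice.Site.tdist x x' : ℝ) / (P.L : ℝ) ^ K)⁻¹) ^ α *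
                  ‖hol C (bgVec mu0sq a K A) x l
                      (covDeriv C (bgVec mu0sq a K A) (propagatorK C Finset.univ (bgVec mu0sq a K A) msq a K g) ⟨x', μ⟩)
                    - covDeriv C (bgVec mu0sq a K A) (propagatorK C Finset.univ (bgVec mu0sq a K A) msq a K g) ⟨x, μ⟩‖
                ≤ c₀ * P.mesh K * Real.exp (-(δA K₀ * (D / (P.L : ℝ) ^ K))) * M := by
  obtain ⟨Cγ, Cδ, CH, Cβ, hCγ, hCδ, hCH, hCβ, cA, hcA, hcube⟩ := cube_inputs_holder_bgVec d L hd hL ha hmu hmsq N C ε₀ hα0 hα1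
  obtain ⟨c₉, hc₉, K₉, cA₉, δ₉, hcδ₉, hfar⟩ := norm_covDeriv_propagatorK_bgVec_decay_of_cubes d L hd hL ha hmu hmsq N C ε₀
  have hlog2 : 0 < Real.log 2 := Real.log_pos (by norm_num)
  have hD1 := D1_nonneg contDiff_hprof hasCompactSupport_hprof
  have hD2 := D2_nonneg contDiff_hprof hasCompactSupport_hprof
  set Cnear : ℝ := CH + (d : ℝ) * (D1 hprof + D2 hprof) / 8 * (2 * (d : ℝ) + 2) * Cδ + (D1 hprof ^ 2 + D2 hprof) / 64 * (d : ℝ) ^ 2 * Cγ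
    with hCnear
  have hCnear0 : 0 < Cnear := by positivity
  refine ⟨4 * 2 ^ d * Cnear + 2 * c₉, by positivity, max (max K₉ 8) (max (⌈(2 : ℝ) ^ (d + 2) * Cβ⌉₊) (8 * d + 24)),
    fun K₀ => min (cA K₀) (cA₉ K₀), fun K₀ => min (Real.log 2 * 4 / (5 * K₀ + 8 * d + 24)) (δ₉ K₀),
    fun K₀ => ⟨lt_min (hcA K₀) (hcδ₉ K₀).1, lt_min (div_pos (mul_pos hlog2 (by norm_num)) (by positivity)) (hcδ₉ K₀).2⟩,
    fun K₀ hK₀ => ?_⟩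
  have hK₀9 : K₉ ≤ K₀ := le_trans (le_trans (le_max_left _ _) (le_max_left _ _)) hK₀
  have hK₀8 : 8 ≤ K₀ := le_trans (le_trans (le_max_right _ _) (le_max_left _ _)) hK₀
  have hK₀C : (2 : ℝ) ^ (d + 2) * Cβ ≤ K₀ :=
    (Nat.le_ceil _).trans (by exact_mod_cast le_trans (le_trans (le_max_left _ _) (le_max_right _ _)) hK₀)
  have hK₀d : 8 * d + 24 ≤ K₀ := le_trans (le_trans (le_max_right _ _) (le_max_right _ _)) hK₀
  have h22 : (2 : ℝ) ^ (d + 2) = 2 ^ d * 4 := by rw [pow_add]; norm_num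
  rw [h22] at hK₀C
  intro P S hPd hPL hK₀M K hK1 hK hN3 hε r hr A hA g M D hg hD0 μ x x' hne l hch hend hlen hDx hDx'
  have hr₁ : r * P.mesh K ≤ cA K₀ := hr.trans (min_le_left _ _)
  have hr₉ : r * P.mesh K ≤ cA₉ K₀ := hr.trans (min_le_right _ _)
  have hcj := fun j => hcube K₀ hK₀8 P S hPd hPL hK₀M hK1 hK hN3 hε hr₁ A hA j
  have hfar' := fun (b : HiggsLattice.PBond P 0) (hb : ∀ z, g z ≠ 0 → D ≤ (HiggsLattice.Site.tdist b.src z : ℝ)) =>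
    hfar K₀ hK₀9 P S hPd hPL hK₀M hK1 hK hN3 hε hr₉ A hA g M D hg hD0 b hb
  subst hPd
  have hL1 : (1 : ℝ) < P.L := by rw [hPL]; exact_mod_cast hL.2
  have hmesh : 0 < P.mesh K := P.mesh_pos K
  have hmesh0 : 0 < P.mesh 0 := P.mesh_pos 0
  have hakP : 0 ≤ B1.aSeq a P.L K := (B1.aSeq_pos ha hL1 hK1).le
  have hM0 : 0 ≤ M := (norm_nonneg _).trans (hg x)
  have hK₀pos : (0 : ℝ) < K₀ := by exact_mod_cast (show 0 < K₀ by omega)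
  have hn0 : (0 : ℝ) < (P.L : ℝ) ^ K := by positivity
  set t : ℝ := (HiggsLattice.Site.tdist x x' : ℝ) with ht_def
  have ht1 : 1 ≤ t := by rw [ht_def]; exact_mod_cast one_le_tdist_of_ne hne
  have ht0 : 0 < t := lt_of_lt_of_le one_pos ht1
  have hq0 : 0 < t / (P.L : ℝ) ^ K := div_pos ht0 hn0
  have hEA : ∀ {δ' : ℝ}, min (Real.log 2 * 4 / (5 * K₀ + 8 * P.d + 24)) (δ₉ K₀) ≤ δ' →
      Real.exp (-(δ' * (D / (P.L : ℝ) ^ K))) ≤ Real.exp (-(min (Real.log 2 * 4 / (5 * K₀ + 8 * P.d + 24)) (δ₉ K₀) * (D / (P.L : ℝ) ^ K))) :=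
    fun h => Real.exp_le_exp.2 (neg_le_neg (mul_le_mul_of_nonneg_right h (by positivity)))
  set Q : ℝ := ‖hol C (bgVec mu0sq a K A) x l
      (covDeriv C (bgVec mu0sq a K A) (propagatorK C Finset.univ (bgVec mu0sq a K A) msq a K g) ⟨x', μ⟩)
    - covDeriv C (bgVec mu0sq a K A) (propagatorK C Finset.univ (bgVec mu0sq a K A) msq a K g) ⟨x, μ⟩‖ with hQ_def
  have hQ0 : 0 ≤ Q := norm_nonneg _
  by_cases hnt : HiggsLattice.Site.tdist x x' ≤ P.L ^ K
  · -- the regime `|x − x′| ≦ L^K`: the walk (2.13) for the Hölder probe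
    have htn : t ≤ (P.L : ℝ) ^ K := by rw [ht_def]; exact_mod_cast hnt
    -- room for the enlarged cylinders: `4(rS + dL^K + 2) ≦ 3·L^KK₀` from `K₀ ≧ 8d + 24`
    have hroom : 4 * (rS P K K₀ + P.d * P.L ^ K + 2) ≤ 3 * half P K K₀ := by
      have h8 := eight_rS_le (P := P) (K := K) (K₀ := K₀)
      have hn1 : 1 ≤ P.L ^ K := Nat.one_le_pow K P.L P.hL
      have hh : P.L ^ K * (8 * P.d + 24) ≤ P.L ^ K * K₀ := Nat.mul_le_mul_left _ hK₀d
      unfold half at h8 ⊢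
      have e1 : P.L ^ K * (8 * P.d + 24) = 8 * (P.d * P.L ^ K) + 24 * P.L ^ K := by ring
      rw [e1] at hh
      generalize P.L ^ K * K₀ = h at h8 hh ⊢
      generalize P.d * P.L ^ K = nd at hh ⊢
      omega
    set rH : ℕ := rS P K K₀ + P.d * P.L ^ K + 2 with hrH
    have hrH0 : (0 : ℝ) < rH := by positivity
    set δ : ℝ := Real.log 2 / (2 * (rH : ℝ)) with hδ_def
    have hδ0 : 0 ≤ δ := by positivity
    have hexp : Real.exp (δ * (2 * (rH : ℝ))) = 2 := by
      rw [hδ_def, div_mul_cancel₀ _ (by positivity), Real.exp_log two_pos]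
    have hsmall : (2 : ℝ) ^ P.d * (Cβ / K₀) * Real.exp (δ * (2 * (rH : ℝ))) ≤ 1 / 2 := by
      rw [hexp]
      have e : (2 : ℝ) ^ P.d * (Cβ / K₀) * 2 = (2 ^ P.d * 2 * Cβ) / K₀ := by ring
      rw [e, div_le_iff₀ hK₀pos]
      linarith
    have hmain := norm_holder_propagatorK_univ_le C hK hK₀M hK₀8 hN3 hroom hmsq a hakP (bgVec mu0sq a K A)
      (γ0 := Cγ * P.mesh K ^ 2) (γD := Cδ * P.mesh K) (γH := CH * (t / (P.L : ℝ) ^ K) ^ α * P.mesh K) (β := Cβ / K₀)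
      (by positivity) (by positivity) (by positivity) (by positivity) hch hend hlen hnt
      (fun j ψ => (hcj j).1 ψ) (fun j ψ y ν hy hs => (hcj j).2.1 ψ y ν hy hs)
      (fun j ψ h1 h2 h3 h4 h5 => (hcj j).2.2.1 ψ μ x x' l h1 h2 h3 h4 hne hch hend h5 hlen)
      (fun j ψ => (hcj j).2.2.2 ψ) hδ0 hsmall g hg hD0 hDx
    rw [hexp] at hmain
    -- the one-letter constant `γ_T ≦ C_near (t/n)^α (L^Kε)`
    have hdd1 : ((dd P : ℝ) + 1) = (P.d : ℝ) := by
      rw [← dd_succ P]; push_cast; ring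
    have hnR : ((((P.L - 1 + 1) ^ K : ℕ)) : ℝ) = (P.L : ℝ) ^ K := by
      rw [B1TorusCubeChart.predL_succ, Nat.cast_pow]
    have hmeshK : P.mesh K = (P.L : ℝ) ^ K * P.mesh 0 := by
      unfold HiggsLattice.Params.mesh; ring
    have hγ : CH * (t / (P.L : ℝ) ^ K) ^ α * P.mesh K
          + ((dd P : ℝ) + 1) * (D1 hprof + D2 hprof) / K₀ * ((2 * l.length + 2) / (((P.L - 1 + 1) ^ K : ℕ) : ℝ)) * (Cδ * P.mesh K)
          + (D1 hprof ^ 2 + D2 hprof) / (K₀ : ℝ) ^ 2 * ((P.d : ℝ) * l.length / ((((P.L - 1 + 1) ^ K : ℕ) : ℝ) ^ 2 * P.mesh 0))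
            * (Cγ * P.mesh K ^ 2)
        ≤ Cnear * (t / (P.L : ℝ) ^ K) ^ α * P.mesh K := by
      rw [hdd1, hnR, hmeshK, hCnear]
      exact gammaT_le hK₀8 hD1 hD2 hCδ.le hCγ.le hn0 hmesh0 ht1 htn (Nat.cast_nonneg _) hlen hα1
    -- the rate: `δ₀(K₀)·D/L^K ≦ δD` from `8(rS + dL^K + 2) ≦ (5K₀ + 8d + 24)L^K`
    have h8 : 8 * (rH : ℝ) ≤ (5 * (K₀ : ℝ) + 8 * P.d + 24) * (P.L : ℝ) ^ K := by
      have h := eight_rS_le (P := P) (K := K) (K₀ := K₀)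
      have h' : ((8 * rS P K K₀ : ℕ) : ℝ) ≤ ((5 * half P K K₀ + 8 * P.L ^ K : ℕ) : ℝ) := by exact_mod_cast h
      have hn1 : (1 : ℝ) ≤ (P.L : ℝ) ^ K := one_le_pow₀ hL1.le
      unfold half at h'
      push_cast at h' ⊢
      rw [hrH]; push_cast
      nlinarith
    have hcmp : Real.log 2 * 4 / (5 * (K₀ : ℝ) + 8 * P.d + 24) * (D / (P.L : ℝ) ^ K) ≤ δ * D := by
      rw [hδ_def, div_mul_div_comm, div_mul_eq_mul_div, div_le_div_iff₀ (by positivity) (by positivity)]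
      have hlogD : 0 ≤ Real.log 2 * D := mul_nonneg hlog2.le hD0
      calc Real.log 2 * 4 * D * (2 * (rH : ℝ)) = Real.log 2 * D * (8 * (rH : ℝ)) := by ring
        _ ≤ Real.log 2 * D * ((5 * (K₀ : ℝ) + 8 * P.d + 24) * (P.L : ℝ) ^ K) := mul_le_mul_of_nonneg_left h8 hlogD
    have hexpD : Real.exp (-(δ * D)) ≤ Real.exp (-(Real.log 2 * 4 / (5 * (K₀ : ℝ) + 8 * P.d + 24) * (D / (P.L : ℝ) ^ K))) :=
      Real.exp_le_exp.2 (by linarith)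
    have hE0 := Real.exp_nonneg (-(min (Real.log 2 * 4 / (5 * K₀ + 8 * P.d + 24)) (δ₉ K₀) * (D / (P.L : ℝ) ^ K)))
    -- assemble: the weight cancels the factor `(t/n)^α`
    have hw : ((t / (P.L : ℝ) ^ K)⁻¹) ^ α * (t / (P.L : ℝ) ^ K) ^ α = 1 := by
      rw [Real.inv_rpow hq0.le, inv_mul_cancel₀ (Real.rpow_pos_of_pos hq0 α).ne']
    have hQ : Q ≤ 4 * 2 ^ P.d * (Cnear * (t / (P.L : ℝ) ^ K) ^ α * P.mesh K)
        * Real.exp (-(min (Real.log 2 * 4 / (5 * K₀ + 8 * P.d + 24)) (δ₉ K₀) * (D / (P.L : ℝ) ^ K))) * M := by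
      refine hmain.trans ?_
      have hE1 := (hexpD.trans (hEA (min_le_left _ _)))
      calc 2 * 2 ^ P.d * ((CH * (t / (P.L : ℝ) ^ K) ^ α * P.mesh K
              + ((dd P : ℝ) + 1) * (D1 hprof + D2 hprof) / K₀ * ((2 * l.length + 2) / (((P.L - 1 + 1) ^ K : ℕ) : ℝ)) * (Cδ * P.mesh K)
              + (D1 hprof ^ 2 + D2 hprof) / (K₀ : ℝ) ^ 2 * ((P.d : ℝ) * l.length / ((((P.L - 1 + 1) ^ K : ℕ) : ℝ) ^ 2 * P.mesh 0))
                * (Cγ * P.mesh K ^ 2)) * 2) * Real.exp (-(δ * D)) * M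
          ≤ 2 * 2 ^ P.d * (Cnear * (t / (P.L : ℝ) ^ K) ^ α * P.mesh K * 2)
              * Real.exp (-(min (Real.log 2 * 4 / (5 * K₀ + 8 * P.d + 24)) (δ₉ K₀) * (D / (P.L : ℝ) ^ K))) * M := by
            gcongr
        _ = _ := by ring
    calc ((t / (P.L : ℝ) ^ K)⁻¹) ^ α * Q
        ≤ ((t / (P.L : ℝ) ^ K)⁻¹) ^ α * (4 * 2 ^ P.d * (Cnear * (t / (P.L : ℝ) ^ K) ^ α * P.mesh K)
            * Real.exp (-(min (Real.log 2 * 4 / (5 * K₀ + 8 * P.d + 24)) (δ₉ K₀) * (D / (P.L : ℝ) ^ K))) * M) :=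
          mul_le_mul_of_nonneg_left hQ (Real.rpow_nonneg (inv_nonneg.2 hq0.le) α)
      _ = (((t / (P.L : ℝ) ^ K)⁻¹) ^ α * (t / (P.L : ℝ) ^ K) ^ α) * (4 * 2 ^ P.d * Cnear * P.mesh K
            * Real.exp (-(min (Real.log 2 * 4 / (5 * K₀ + 8 * P.d + 24)) (δ₉ K₀) * (D / (P.L : ℝ) ^ K))) * M) := by ring
      _ = 4 * 2 ^ P.d * Cnear * P.mesh K
            * Real.exp (-(min (Real.log 2 * 4 / (5 * K₀ + 8 * P.d + 24)) (δ₉ K₀) * (D / (P.L : ℝ) ^ K))) * M := by rw [hw, one_mul]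
      _ ≤ (4 * 2 ^ P.d * Cnear + 2 * c₉) * P.mesh K
            * Real.exp (-(min (Real.log 2 * 4 / (5 * K₀ + 8 * P.d + 24)) (δ₉ K₀) * (D / (P.L : ℝ) ^ K))) * M := by
          gcongr; linarith
  · -- the regime `|x − x′| > L^K`: «a simple consequence of the corresponding inequality for the derivative only» — both bonds
    have htn : (P.L : ℝ) ^ K < t := by
      rw [ht_def]; exact_mod_cast (not_le.1 hnt)
    have hw1 : ((t / (P.L : ℝ) ^ K)⁻¹) ^ α ≤ 1 :=
      Real.rpow_le_one (inv_nonneg.2 hq0.le) (inv_le_one_of_one_le₀ ((one_le_div hn0).2 htn.le)) hα0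
    have h1 := hfar' ⟨x', μ⟩ hDx'
    have h2 := hfar' ⟨x, μ⟩ hDx
    have hE1 := hEA (min_le_right _ _)
    have hQ : Q ≤ 2 * c₉ * P.mesh K * Real.exp (-(min (Real.log 2 * 4 / (5 * K₀ + 8 * P.d + 24)) (δ₉ K₀) * (D / (P.L : ℝ) ^ K))) * M := by
      refine (norm_sub_le _ _).trans ?_
      rw [norm_hol_apply]
      calc ‖covDeriv C (bgVec mu0sq a K A) (propagatorK C Finset.univ (bgVec mu0sq a K A) msq a K g) ⟨x', μ⟩‖
            + ‖covDeriv C (bgVec mu0sq a K A) (propagatorK C Finset.univ (bgVec mu0sq a K A) msq a K g) ⟨x, μ⟩‖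
          ≤ c₉ * P.mesh K * Real.exp (-(δ₉ K₀ * (D / (P.L : ℝ) ^ K))) * M
            + c₉ * P.mesh K * Real.exp (-(δ₉ K₀ * (D / (P.L : ℝ) ^ K))) * M := add_le_add h1 h2
        _ = 2 * c₉ * P.mesh K * Real.exp (-(δ₉ K₀ * (D / (P.L : ℝ) ^ K))) * M := by ring
        _ ≤ 2 * c₉ * P.mesh K * Real.exp (-(min (Real.log 2 * 4 / (5 * K₀ + 8 * P.d + 24)) (δ₉ K₀) * (D / (P.L : ℝ) ^ K))) * M := by
            gcongr
    have hE0 := Real.exp_nonneg (-(min (Real.log 2 * 4 / (5 * K₀ + 8 * P.d + 24)) (δ₉ K₀) * (D / (P.L : ℝ) ^ K)))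
    calc ((t / (P.L : ℝ) ^ K)⁻¹) ^ α * Q ≤ 1 * Q := mul_le_mul_of_nonneg_right hw1 hQ0
      _ ≤ 2 * c₉ * P.mesh K * Real.exp (-(min (Real.log 2 * 4 / (5 * K₀ + 8 * P.d + 24)) (δ₉ K₀) * (D / (P.L : ℝ) ^ K))) * M := by
          rw [one_mul]; exact hQ
      _ ≤ (4 * 2 ^ P.d * Cnear + 2 * c₉) * P.mesh K
            * Real.exp (-(min (Real.log 2 * 4 / (5 * K₀ + 8 * P.d + 24)) (δ₉ K₀) * (D / (P.L : ℝ) ^ K))) * M := by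
          gcongr; nlinarith [pow_pos (two_pos : (0:ℝ) < 2) P.d]

/-- **THE SAME, WITH THE CUBE CONDITION AS `K₀ ∣ M`, `3K₀ ≦ 2M`** (then `3·L^KK₀ ≦ |T_ε|_μ` at every level `K ≦ K_P`).
[cite: Balaban1982Higgs1, Prop. 2.1 (2.24) p.610; (3.29) p.617] [cite: Balaban1983RegularityDecay, Theorem (1.9) p.573] -/
theorem norm_holder_propagatorK_bgVec_decay (d L : ℕ) (hd : 1 ≤ d) (hL : Odd L ∧ 1 < L) {a : ℝ} (ha : 0 < a) {mu0sq msq : ℝ}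
    (hmu : 0 < mu0sq) (hmsq : 0 < msq) (N : ℕ) (C : ChargeData N) (ε₀ : ℝ) {α : ℝ} (hα0 : 0 ≤ α) (hα1 : α < 1) :
    ∃ c₀ : ℝ, 0 < c₀ ∧ ∃ K₀min : ℕ, ∃ cA δA : ℕ → ℝ, (∀ K₀, 0 < cA K₀ ∧ 0 < δA K₀) ∧ ∀ K₀ : ℕ, K₀min ≤ K₀ →
      ∀ (P : HiggsLattice.Params) (_S : Shape P), P.d = d → P.L = L → K₀ ∣ P.M → 3 * K₀ ≤ 2 * P.M →
      ∀ {K : ℕ}, 1 ≤ K → K ≤ P.K → P.mesh K ≤ ε₀ →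
      ∀ {r : ℝ}, r * P.mesh K ≤ cA K₀ →
      ∀ A : HiggsLattice.VecField P K, (∀ x, ‖toSite A x‖ ≤ r) →
        ∀ (g : HiggsLattice.ScalarField P 0 N) (M D : ℝ), (∀ x, ‖g x‖ ≤ M) → 0 ≤ D →
          ∀ (μ : Fin P.d) (x x' : HiggsLattice.Site P 0), x' ≠ x → ∀ l : List (HiggsLattice.Site P 0), IsTChain x l → pathEnd x l = x' →
            (l.length : ℝ) ≤ (P.d : ℝ) * HiggsLattice.Site.tdist x x' →
            (∀ z, g z ≠ 0 → D ≤ (HiggsLattice.Site.tdist x z : ℝ)) → (∀ z, g z ≠ 0 → D ≤ (HiggsLattice.Site.tdist x' z : ℝ)) →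
              (((HiggsLattice.Site.tdist x x' : ℝ) / (P.L : ℝ) ^ K)⁻¹) ^ α *
                  ‖hol C (bgVec mu0sq a K A) x l
                      (covDeriv C (bgVec mu0sq a K A) (propagatorK C Finset.univ (bgVec mu0sq a K A) msq a K g) ⟨x', μ⟩)
                    - covDeriv C (bgVec mu0sq a K A) (propagatorK C Finset.univ (bgVec mu0sq a K A) msq a K g) ⟨x, μ⟩‖
                ≤ c₀ * P.mesh K * Real.exp (-(δA K₀ * (D / (P.L : ℝ) ^ K))) * M := by
  obtain ⟨c₀, hc₀, K₀min, cA, δA, hcδ, h⟩ := norm_holder_propagatorK_bgVec_decay_of_cubes d L hd hL ha hmu hmsq N C ε₀ hα0 hα1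
  exact ⟨c₀, hc₀, K₀min, cA, δA, hcδ, fun K₀ hK₀ P S hPd hPL hK₀M h3M K hK1 hK hε r hr A hA g M D hg hD0 μ x x' hne l hch hend hlen hDx hDx' =>
    h K₀ hK₀ P S hPd hPL hK₀M hK1 hK (three_half_le_sites hK h3M) hε hr A hA g M D hg hD0 μ x x' hne l hch hend hlen hDx hDx'⟩

end Main

end Literature.MathematicalPhysics.QuantumFieldTheory.Balaban1983to89.B1Ineq224BackgroundTorus
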